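import Summits.QuantumFields.BalabanUV.Beta.GAN24.T2HybridCells
import Summits.QuantumFields.BalabanUV.Beta.GAN24.T2RecHybridSplit

/-!
# `BalabanUV.Beta.GAN24.T2HybridCellsContact` — binder row G-an2-4 / (CONV-C), W-slot CT-W ((R-HYB) + (R-CT)): **gan24-p2's CONTACT LITERAL OF THE HYBRID SPLIT IS THE
# LEVEL SUM OF UNDRESSED TRANSPORTS OF THE DRESSING CELLS** — `CONTACT_n = Σ_{l<n} 𝒯^B(l+1, n−1−l) (lin4 c₄ G̃_l Lc T̃_l − lin4 c₄ K̃_l Lc T̃_l)` for the slotted family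
# (ANY second kernel family `K`) and for an2's comb tower (`K = KInvStep`, road «W3»'s transport OF RECORD above every cell)

NOT IN PRINT; OUR BOOKKEEPING ([folklore] `T2HybridCells.contact_eq_sum_transport_cell` on the class of bounded bi-tables, at gan24-p2 g35's (F1)∕(R-HYB) letters
(`T2RecOfUnitSplit`, `T2RecHybridSplit` ✓ p310721); G-an2-4 formalisation swarm, leaf prover `b2b-balaban-gan24-formalise-leaf-01`, gen 62; OFFER O-leaf01-g62-1,
journal l.37593 ∕ l.37750; name PROVISIONAL).  The left-hand sides below are the second summands of `T2RecHybridSplit.unitS₂_T2RecOf_eq_hyb_add_contact_of_letters` ∕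
`unitS₂_T2RecAt_eq_hyb_add_contact` TOKEN FOR TOKEN («A above, hybrid below» in p2's `transport_sub_transport_eq_sum`; «B above, member below» here: above each
cell sits the UNDRESSED transport only, below it the dressed member itself).  HONEST FRAMING (cell contract, verbatim): «discharging `BetaPertH` makes Bałaban's UV
stability UNCONDITIONAL — a real constructive-QFT result; it is NOT the continuum limit and NOT the Clay problem.»  HONEST DEPENDENCY (verbatim): «continuum YM on T⁴ ⇐
BetaPertH ∧ nine spine estimates (0/9 proved); BetaPertH ⇐ (D1) ∧ (D4) ∧ CAP+tail; G-an2-4 gates asym, D1 and NE2/3/4.»  Asserts NO shape of Bałaban's tables; discharges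
NOTHING of «T2Shape» ∕ «T2Drift» ∕ (hW, hWall); NOT «W-slot closed», NEVER «G-an2-4 closed» as (CONV-C); NOT D1, NOT `BetaPertH`, NOT continuum, NOT Clay.
0 cited facts, 0 `def`, 0 `def … : Prop`, 0 sorry.
-/

noncomputable section

open Finset
open scoped BigOperators
open Literature.MathematicalPhysics.QuantumFieldTheory
open Literature.MathematicalPhysics.QuantumFieldTheory.Balaban1983to89
open Literature.MathematicalPhysics.QuantumFieldTheory.Balaban1983to89.Beta
open ExpKernelCalculus (MKer Decays BiLoc VertexFamily VertexFamily₂)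
open OneStepResolventKernel (Fib LocStencil decays_mono)
open OneStepKernelFamily (KInvStep decays_KInvStep)
open AffineAveraging (box toSite)
open AveragingMixedJetTables (mixFFAt)
open SecondOrderResponse (W2SymOfK LocStencilFM)
open BalabanCompositeJets (LocStencil₂)
open BalabanStepJetsSucc (mmRead)
open BalabanStepW2 (K3OfK M2Of)
open Summit.QuantumFields.BalabanUV.Beta.HessKerDressedUnits (unitK unitS decays_unitK)
open Summit.QuantumFields.BalabanUV.Beta.SecondOrderUnits (unitM unitS₂ unitM₂)
open Summit.QuantumFields.BalabanUV.Beta.AxialDressingRooted (coDressKBmAt dressKBmAt coProjBmAtK decays_coDressKBmAt_KInvStep)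
open Summit.QuantumFields.BalabanUV.Beta.SpineRooted (T2RecOf T2RecAt SpureRecAt M1At T2RecOf_comb locStencil_SpureRecAt vertexFamily_M1At T2RecAt_loc_of_slot)
open Summit.QuantumFields.BalabanUV.Beta.MixedJetTablesPlug (hmix_an1)
open Summit.QuantumFields.BalabanUV.Beta.GAN24.CombesThomas (sfStep smStep sfStep_ne_zero smStep_ne_zero)
open Summit.QuantumFields.BalabanUV.Beta.GAN24.T2RecursionAffine (lin4)
open Summit.QuantumFields.BalabanUV.Beta.GAN24.AffineUnroll (transport)
open Summit.QuantumFields.BalabanUV.Beta.GAN24.Lin4Additive (lin4_bdd)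
open Summit.QuantumFields.BalabanUV.Beta.GAN24.T2UnitSplitLevels (bdd₄_zero bdd₄_add bdd₄_sub lin4_add_of_bdd₄)
open Summit.QuantumFields.BalabanUV.Beta.GAN24.T2UnitSplitShapes (bdd₄_of_locStencil₂)
open Summit.QuantumFields.BalabanUV.Beta.GAN24.T2RecOfUnitSplit (unitS₂_T2RecOf_succ_eq_lin4_add step_data_of_letters bdd₄_unitS₂_T2RecOf_of_letters)
open Summit.QuantumFields.BalabanUV.Beta.GAN24.T2RecHybridSplit (bdd₄_source_of_letters)
open Summit.QuantumFields.BalabanUV.Beta.GAN24.T2HybridCells (contact_eq_sum_transport_cell)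
open Summit.QuantumFields.BalabanUV.Beta.GAN24.T2RecHybridSplit (bdd₄_source_of_letters)

namespace Summit.QuantumFields.BalabanUV.Beta.GAN24.T2HybridCellsContact

variable {d : ℕ}

/-! ## §1 The slotted family modulo (F1)'s letters -/

section Slotted

variable {Lc : ℕ} [NeZero Lc] (G K : ℕ → MKer (d + 1) (Fib d)) (S M : ℕ → Fin (d + 1) → (Fin (d + 1) → ℤ) → MKer (d + 1) (Fib d)) (cE₂ cB : ℝ)
  (Tc : Fin 4 → Fin 4 → Fin 4 → Fin 4 → ℝ)
  {vh₂S mixFF : Fin (d + 1) → (Fin (d + 1) → ℤ) → Fin (d + 1) → (Fin (d + 1) → ℤ) → MKer (d + 1) (Fib d)}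

/-- NOT IN PRINT; OUR BOOKKEEPING ([folklore] `T2HybridCells.contact_eq_sum_transport_cell` on the bounded class; the affine step from (F1)'s `unitS₂_T2RecOf_succ_eq_lin4_add` +
`step_data_of_letters`, the sources' bounded entries from p2's `bdd₄_source_of_letters`).  **gan24-p2's CONTACT LITERAL OF THE SLOTTED TOWER = THE LEVEL SUM OF UNDRESSED
TRANSPORTS OF THE CELLS**, for ANY second kernel family `K` decaying per level. -/
theorem contact_eq_sum_transport_cell_of_letters (hLc : 1 ≤ Lc)
    (hBff : ∀ κ u κ' u' x z (α β : Fin (d + 1)), vh₂S κ u κ' u' x z (Sum.inl α) (Sum.inl β) = 0)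
    (hBmm : ∀ κ u κ' u' x z (μ ν : Fin (d + 1)), vh₂S κ u κ' u' x z (Sum.inr μ) (Sum.inr ν) = 0)
    (hG : ∀ j : ℕ, ∃ δ C : ℝ, 0 < δ ∧ 0 ≤ C ∧ Decays (G j) C δ) (hK : ∀ j : ℕ, ∃ δ C : ℝ, 0 < δ ∧ 0 ≤ C ∧ Decays (K j) C δ)
    (hS : ∀ j : ℕ, ∃ Cs δ : ℝ, 0 < δ ∧ LocStencil (S j) Cs δ) (hM : ∀ j : ℕ, ∃ CM δ : ℝ, 0 < δ ∧ VertexFamily (M j) Lc CM δ)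
    (hBl : ∃ C δ : ℝ, 0 < δ ∧ LocStencil₂ vh₂S C δ) (hmix : ∃ C δ : ℝ, 0 < δ ∧ LocStencilFM Lc mixFF C δ) (n : ℕ) :
    ((transport (fun j => lin4 (cE₂ * (Lc : ℝ) ^ (2 * (d + 1))) (unitK (sfStep Lc j) (smStep d Lc j) (G j)) Lc) 0 n
            (unitS₂ (sfStep Lc 0) (smStep d Lc 0) (T2RecOf d Lc G S M cE₂ cB Tc vh₂S mixFF 0)) -
          transport (fun j => lin4 (cE₂ * (Lc : ℝ) ^ (2 * (d + 1))) (unitK (sfStep Lc j) (smStep d Lc j) (K j)) Lc) 0 n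
            (unitS₂ (sfStep Lc 0) (smStep d Lc 0) (T2RecOf d Lc G S M cE₂ cB Tc vh₂S mixFF 0))) +
        ∑ i ∈ Finset.range n, (transport (fun j => lin4 (cE₂ * (Lc : ℝ) ^ (2 * (d + 1))) (unitK (sfStep Lc j) (smStep d Lc j) (G j)) Lc) (i + 1) (n - 1 - i)
            (fun κ u κ' u' => (cE₂ * (Lc : ℝ) ^ (2 * (d + 1))) • mmRead Lc (K3OfK (unitK (sfStep Lc i) (smStep d Lc i) (G i)) Lc
            (unitS (sfStep Lc i) (smStep d Lc i) (S i)) (unitM (sfStep Lc i) (smStep d Lc i) (M i)) (W2SymOfK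
            (unitK (sfStep Lc i) (smStep d Lc i) (G i)) Lc (unitS (sfStep Lc i) (smStep d Lc i) (S i))
            (unitM (sfStep Lc i) (smStep d Lc i) (M i)) 0
            (unitM₂ (sfStep Lc i) (smStep d Lc i) (M2Of d Lc mixFF i))) κ u κ' u') + cB • vh₂S κ u κ' u') -
          transport (fun j => lin4 (cE₂ * (Lc : ℝ) ^ (2 * (d + 1))) (unitK (sfStep Lc j) (smStep d Lc j) (K j)) Lc) (i + 1) (n - 1 - i)
            (fun κ u κ' u' => (cE₂ * (Lc : ℝ) ^ (2 * (d + 1))) • mmRead Lc (K3OfK (unitK (sfStep Lc i) (smStep d Lc i) (G i)) Lc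
            (unitS (sfStep Lc i) (smStep d Lc i) (S i)) (unitM (sfStep Lc i) (smStep d Lc i) (M i)) (W2SymOfK
            (unitK (sfStep Lc i) (smStep d Lc i) (G i)) Lc (unitS (sfStep Lc i) (smStep d Lc i) (S i))
            (unitM (sfStep Lc i) (smStep d Lc i) (M i)) 0
            (unitM₂ (sfStep Lc i) (smStep d Lc i) (M2Of d Lc mixFF i))) κ u κ' u') + cB • vh₂S κ u κ' u'))) =
      ∑ l ∈ Finset.range n, transport (fun j => lin4 (cE₂ * (Lc : ℝ) ^ (2 * (d + 1))) (unitK (sfStep Lc j) (smStep d Lc j) (K j)) Lc) (l + 1) (n - 1 - l)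
          (lin4 (cE₂ * (Lc : ℝ) ^ (2 * (d + 1))) (unitK (sfStep Lc l) (smStep d Lc l) (G l)) Lc
              (unitS₂ (sfStep Lc l) (smStep d Lc l) (T2RecOf d Lc G S M cE₂ cB Tc vh₂S mixFF l)) -
            lin4 (cE₂ * (Lc : ℝ) ^ (2 * (d + 1))) (unitK (sfStep Lc l) (smStep d Lc l) (K l)) Lc
              (unitS₂ (sfStep Lc l) (smStep d Lc l) (T2RecOf d Lc G S M cE₂ cB Tc vh₂S mixFF l))) := by
  have hGu : ∀ j, ∃ C δ : ℝ, 0 < δ ∧ Decays (unitK (sfStep Lc j) (smStep d Lc j) (G j)) C δ := fun j => by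
    obtain ⟨δ, C, hδ, -, h⟩ := hG j
    exact ⟨_, δ, hδ, decays_unitK (sf := sfStep Lc j) (sm := smStep d Lc j) h⟩
  have hKu : ∀ j, ∃ C δ : ℝ, 0 < δ ∧ Decays (unitK (sfStep Lc j) (smStep d Lc j) (K j)) C δ := fun j => by
    obtain ⟨δ, C, hδ, -, h⟩ := hK j
    exact ⟨_, δ, hδ, decays_unitK (sf := sfStep Lc j) (sm := smStep d Lc j) h⟩
  have hrec : ∀ j, (unitS₂ (sfStep Lc (j + 1)) (smStep d Lc (j + 1)) (T2RecOf d Lc G S M cE₂ cB Tc vh₂S mixFF (j + 1))) =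
      (fun j => lin4 (cE₂ * (Lc : ℝ) ^ (2 * (d + 1))) (unitK (sfStep Lc j) (smStep d Lc j) (G j)) Lc) j
        (unitS₂ (sfStep Lc j) (smStep d Lc j) (T2RecOf d Lc G S M cE₂ cB Tc vh₂S mixFF j)) +
      (fun κ u κ' u' => (cE₂ * (Lc : ℝ) ^ (2 * (d + 1))) • mmRead Lc (K3OfK (unitK (sfStep Lc j) (smStep d Lc j) (G j)) Lc
            (unitS (sfStep Lc j) (smStep d Lc j) (S j)) (unitM (sfStep Lc j) (smStep d Lc j) (M j)) (W2SymOfK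
            (unitK (sfStep Lc j) (smStep d Lc j) (G j)) Lc (unitS (sfStep Lc j) (smStep d Lc j) (S j))
            (unitM (sfStep Lc j) (smStep d Lc j) (M j)) 0
            (unitM₂ (sfStep Lc j) (smStep d Lc j) (M2Of d Lc mixFF j))) κ u κ' u') + cB • vh₂S κ u κ' u') := fun j => by
    obtain ⟨C, δ, C₀, C₁, hδ, hKj, h₀, hW⟩ := step_data_of_letters G S M cE₂ cB Tc hLc hG hS hM hBl hmix j
    exact unitS₂_T2RecOf_succ_eq_lin4_add G S M cE₂ cB Tc vh₂S mixFF hBff hBmm j hδ hKj h₀ hW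
  have hb := fun j => bdd₄_source_of_letters G S M cE₂ cB vh₂S mixFF Tc hLc hBff hBmm hG hS hM hBl hmix j
  refine contact_eq_sum_transport_cell (A := (fun j => lin4 (cE₂ * (Lc : ℝ) ^ (2 * (d + 1))) (unitK (sfStep Lc j) (smStep d Lc j) (G j)) Lc))
    (B := (fun j => lin4 (cE₂ * (Lc : ℝ) ^ (2 * (d + 1))) (unitK (sfStep Lc j) (smStep d Lc j) (K j)) Lc))
    (P := fun X => ∃ B : ℝ, ∀ κ u κ' u' x z a b, |X κ u κ' u' x z a b| ≤ B)
    (x := fun j => (unitS₂ (sfStep Lc j) (smStep d Lc j) (T2RecOf d Lc G S M cE₂ cB Tc vh₂S mixFF j)))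
    bdd₄_zero (fun _ _ => bdd₄_add) (fun _ _ => bdd₄_sub) (fun j Y hY => ?_) (fun j Y hY => ?_) (fun j Y Z hY hZ => ?_) (fun j Y Z hY hZ => ?_)
    (bdd₄_unitS₂_T2RecOf_of_letters G S M cE₂ cB Tc hLc hG hS hM hBl hmix 0) hb hrec n
  · obtain ⟨C, δ, hδ, h⟩ := hGu j
    exact lin4_bdd h hδ _ Lc hY
  · obtain ⟨C, δ, hδ, h⟩ := hKu j
    exact lin4_bdd h hδ _ Lc hY
  · obtain ⟨C, δ, hδ, h⟩ := hGu j
    exact lin4_add_of_bdd₄ h hδ _ Lc hY hZ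
  · obtain ⟨C, δ, hδ, h⟩ := hKu j
    exact lin4_add_of_bdd₄ h hδ _ Lc hY hZ

end Slotted

/-! ## §2 The COMB data: letters discharged -/

section Comb

variable {Lc : ℕ} [NeZero Lc] {r : Fin (d + 1) → ℕ}

/-- NOT IN PRINT; OUR BOOKKEEPING.  **gan24-p2's COMB CONTACT LITERAL** (the second summand of `T2RecHybridSplit.unitS₂_T2RecAt_eq_hyb_add_contact`, token for token) **IS THE
LEVEL SUM OF UNDRESSED TRANSPORTS OF THE DRESSING CELLS** — above every cell sits road W3's transport OF RECORD only (rows `TransportRows.transport_rows_three`, TREE at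
`d = 3`); below it the dressed member `T̃_l` (letters discharged as in p2's §4: asym1's `decays_coDressKBmAt_KInvStep`, `decays_KInvStep`, an2's `locStencil_SpureRecAt` ∕
`vertexFamily_M1At`, an1's `hmix_an1`). -/
theorem contact_comb_eq_sum_transport_cell (hLc : 1 ≤ Lc) (hr : r ∈ box (d + 1) Lc) (cE cVH cΛ cE₂ cB : ℝ)
    (Tc : Fin 4 → Fin 4 → Fin 4 → Fin 4 → ℝ) {vh₂S : Fin (d + 1) → (Fin (d + 1) → ℤ) → Fin (d + 1) → (Fin (d + 1) → ℤ) → MKer (d + 1) (Fib d)}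
    (hBff : ∀ κ u κ' u' x z (α β : Fin (d + 1)), vh₂S κ u κ' u' x z (Sum.inl α) (Sum.inl β) = 0)
    (hBmm : ∀ κ u κ' u' x z (μ ν : Fin (d + 1)), vh₂S κ u κ' u' x z (Sum.inr μ) (Sum.inr ν) = 0)
    (hB : ∃ C δ : ℝ, 0 < δ ∧ LocStencil₂ vh₂S C δ) (n : ℕ) :
    ((transport (fun j => lin4 (cE₂ * (Lc : ℝ) ^ (2 * (d + 1))) (unitK (sfStep Lc j) (smStep d Lc j) (coDressKBmAt (toSite r) Lc (KInvStep (d := d) Lc j))) Lc) 0 n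
            (unitS₂ (sfStep Lc 0) (smStep d Lc 0) (T2RecAt d Lc (toSite r) cE cVH cΛ cE₂ cB Tc vh₂S (mixFFAt (toSite r) Lc) 0)) -
          transport (fun j => lin4 (cE₂ * (Lc : ℝ) ^ (2 * (d + 1))) (unitK (sfStep Lc j) (smStep d Lc j) (KInvStep (d := d) Lc j)) Lc) 0 n
            (unitS₂ (sfStep Lc 0) (smStep d Lc 0) (T2RecAt d Lc (toSite r) cE cVH cΛ cE₂ cB Tc vh₂S (mixFFAt (toSite r) Lc) 0))) +
        ∑ i ∈ Finset.range n, (transport (fun j => lin4 (cE₂ * (Lc : ℝ) ^ (2 * (d + 1))) (unitK (sfStep Lc j) (smStep d Lc j) (coDressKBmAt (toSite r) Lc (KInvStep (d := d) Lc j))) Lc) (i + 1) (n - 1 - i)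
            (fun κ u κ' u' => (cE₂ * (Lc : ℝ) ^ (2 * (d + 1))) • mmRead Lc (K3OfK (unitK (sfStep Lc i) (smStep d Lc i) (coDressKBmAt (toSite r) Lc (KInvStep (d := d) Lc i))) Lc
            (unitS (sfStep Lc i) (smStep d Lc i) (SpureRecAt d Lc (toSite r) cE cVH cΛ i)) (unitM (sfStep Lc i) (smStep d Lc i) (M1At d Lc (toSite r) cΛ i)) (W2SymOfK
            (unitK (sfStep Lc i) (smStep d Lc i) (coDressKBmAt (toSite r) Lc (KInvStep (d := d) Lc i))) Lc (unitS (sfStep Lc i) (smStep d Lc i) (SpureRecAt d Lc (toSite r) cE cVH cΛ i))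
            (unitM (sfStep Lc i) (smStep d Lc i) (M1At d Lc (toSite r) cΛ i)) 0
            (unitM₂ (sfStep Lc i) (smStep d Lc i) (M2Of d Lc (mixFFAt (toSite r) Lc) i))) κ u κ' u') + cB • vh₂S κ u κ' u') -
          transport (fun j => lin4 (cE₂ * (Lc : ℝ) ^ (2 * (d + 1))) (unitK (sfStep Lc j) (smStep d Lc j) (KInvStep (d := d) Lc j)) Lc) (i + 1) (n - 1 - i)
            (fun κ u κ' u' => (cE₂ * (Lc : ℝ) ^ (2 * (d + 1))) • mmRead Lc (K3OfK (unitK (sfStep Lc i) (smStep d Lc i) (coDressKBmAt (toSite r) Lc (KInvStep (d := d) Lc i))) Lc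
            (unitS (sfStep Lc i) (smStep d Lc i) (SpureRecAt d Lc (toSite r) cE cVH cΛ i)) (unitM (sfStep Lc i) (smStep d Lc i) (M1At d Lc (toSite r) cΛ i)) (W2SymOfK
            (unitK (sfStep Lc i) (smStep d Lc i) (coDressKBmAt (toSite r) Lc (KInvStep (d := d) Lc i))) Lc (unitS (sfStep Lc i) (smStep d Lc i) (SpureRecAt d Lc (toSite r) cE cVH cΛ i))
            (unitM (sfStep Lc i) (smStep d Lc i) (M1At d Lc (toSite r) cΛ i)) 0
            (unitM₂ (sfStep Lc i) (smStep d Lc i) (M2Of d Lc (mixFFAt (toSite r) Lc) i))) κ u κ' u') + cB • vh₂S κ u κ' u'))) =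
      ∑ l ∈ Finset.range n, transport (fun j => lin4 (cE₂ * (Lc : ℝ) ^ (2 * (d + 1))) (unitK (sfStep Lc j) (smStep d Lc j) (KInvStep (d := d) Lc j)) Lc) (l + 1) (n - 1 - l)
          (lin4 (cE₂ * (Lc : ℝ) ^ (2 * (d + 1))) (unitK (sfStep Lc l) (smStep d Lc l) (coDressKBmAt (toSite r) Lc (KInvStep (d := d) Lc l))) Lc
              (unitS₂ (sfStep Lc l) (smStep d Lc l) (T2RecAt d Lc (toSite r) cE cVH cΛ cE₂ cB Tc vh₂S (mixFFAt (toSite r) Lc) l)) -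
            lin4 (cE₂ * (Lc : ℝ) ^ (2 * (d + 1))) (unitK (sfStep Lc l) (smStep d Lc l) (KInvStep (d := d) Lc l)) Lc
              (unitS₂ (sfStep Lc l) (smStep d Lc l) (T2RecAt d Lc (toSite r) cE cVH cΛ cE₂ cB Tc vh₂S (mixFFAt (toSite r) Lc) l))) := by
  have h := contact_eq_sum_transport_cell_of_letters (fun j => coDressKBmAt (toSite r) Lc (KInvStep (d := d) Lc j)) (fun j => KInvStep (d := d) Lc j)
    (SpureRecAt d Lc (toSite r) cE cVH cΛ) (M1At d Lc (toSite r) cΛ) cE₂ cB Tc (vh₂S := vh₂S) (mixFF := mixFFAt (toSite r) Lc) hLc hBff hBmm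
    (fun j => decays_coDressKBmAt_KInvStep (d := d) hr j) (fun j => decays_KInvStep (d := d) (Lc := Lc) j) (fun j => locStencil_SpureRecAt hLc hr cE cVH cΛ j)
    (fun j => ⟨_, 1, one_pos, vertexFamily_M1At hLc hr cΛ j zero_le_one⟩) hB (hmix_an1 hLc hr) n
  simp only [T2RecOf_comb] at h
  exact h

end Comb

end Summit.QuantumFields.BalabanUV.Beta.GAN24.T2HybridCellsContact

end
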